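import Summits.ResolutionOfSingularities.ResolutionOfSingularities.Theorems.WeightedInvariantHypersurfaceCentreAssemblyMaxLocus
import Summits.ResolutionOfSingularities.ResolutionOfSingularities.Theorems.WeightedInvariantHypersurfaceCentreAssemblyPointDict
import HarnessLib

/-!
# Door assembly H2c″ — [S6] kernel: local equations of an INTEGRAL hypersurface are prime, hence `0 < ι_max`

Route `ResolutionOfSingularities/WeightedInvariant`, crux `Theses.WeightedInvariant.HypersurfaceCentreConstruction`
(stmt-ResolutionOfSingularities-19897), door line `local-engine`, skeleton v3.1, assembly stub **[S6]** `stub_iotaMax_lt_of_step`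
(holder res-L1-w43-stub-9 = res-D-brk-1; his proof plan of record, STATUS l.35153: «M := iotaMax X > 0 by
`one_le_iota_of_prime` at a point of maxLocus, F/1 prime since V(X) integral»).  This file supplies that step:

* `isPrime_stalkIdeal_of_isIntegral` — for an ideal sheaf `X` with `V(X)` INTEGRAL and `y ∈ V(X)`, the stalk `X_y ⊆ 𝒪_{Y,y}`
  is a prime ideal (`𝒪_{Y,y} ⧸ X_y ≅ 𝒪_{V(X),x}`, a domain);
* `prime_of_stalkIdeal_eq_span`, `prime_germ_of_mem_singImage`, `prime_algebraMap_of_mem_singImage` — so a local equation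
  (`X_y = (g)`, `g ≠ 0`; in stalk / germ / localized-model form) is a PRIME element;
* `one_le_iotaAt_of_mem_singImage` — for `ι`, `J` with (c6) `IotaIsoInvariant`, (c12a) `IotaUnitInvariant`, (c7)
  `IotaGenerizationMonotone`, (c9′) `CanonicalGameClause p`: over a perfect field `k` of characteristic `p`, `Y → Spec k` smooth,
  `X` locally principal with `V(X)` integral, at every point `y ∈ singImage X`: `1 ≤ iotaAt ι X y` (the position
  `(Γ(Y,U)_𝔮, F/1)` is an e.f.t. regular local position with `F/1` prime in `𝔪²`; `one_le_iota_of_prime`, p504597);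
* `iotaMax_pos` — hence `0 < iotaMax ι X` when `V(X)` is not regular.

The clauses enter as HYPOTHESES; nothing about Hironaka's problem is claimed.  AI-written; weaker than expert review.
-/

noncomputable section

set_option linter.dupNamespace false -- mandated namespace of this single-conjunct summit

open CategoryTheory AlgebraicGeometry TopologicalSpace IsLocalRing
open Literature.AlgebraicGeometry.Resolution
open Summit.ResolutionOfSingularities.ResolutionOfSingularities.Theorems

namespace Summit.ResolutionOfSingularities.ResolutionOfSingularities.Cruxes.HypersurfaceCentreConstruction.LocalEngine

/-! ## Local equations of an integral hypersurface are prime -/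

section Prime

variable {Y : Scheme.{0}} (X : Y.IdealSheafData)

/-- **The stalk ideal of an ideal sheaf with INTEGRAL zero scheme is prime** at every point of its support:
`𝒪_{Y,y} ⧸ X_y` is the local ring of `V(X)` at the point over `y` (the stalk map of the closed immersion `V(X) → Y` is
onto with kernel `X_y`), a domain. [folklore] -/
theorem isPrime_stalkIdeal_of_isIntegral [IsIntegral X.subscheme] {y : Y} (hy : y ∈ X.support) :
    (stalkIdeal X y).IsPrime := by
  obtain ⟨s, hs⟩ : y ∈ Set.range X.subschemeι := by
    rw [Scheme.IdealSheafData.range_subschemeι]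
    exact hy
  have hker : RingHom.ker (X.subschemeι.stalkMap s).hom = stalkIdeal X (X.subschemeι.base s) := by
    rw [← stalkIdeal_ker_eq_ker_stalkMap X.subschemeι s, Scheme.IdealSheafData.ker_subschemeι]
  have hs' : X.subschemeι.base s = y := hs
  rw [← hs', ← hker]
  exact RingHom.ker_isPrime _

/-- A generator of the stalk ideal of an integral hypersurface is a prime element (when non-zero). [folklore] -/
theorem prime_of_stalkIdeal_eq_span [IsIntegral X.subscheme] {y : Y} (hy : y ∈ X.support)
    {g : Y.presheaf.stalk y} (hg : stalkIdeal X y = Ideal.span {g}) (hg0 : g ≠ 0) : Prime g :=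
  (Ideal.span_singleton_prime hg0).mp (hg ▸ isPrime_stalkIdeal_of_isIntegral X hy)

/-- At a point of the non-regular locus (regular ambient stalk), `localGenerator X y` is a prime element. [folklore] -/
theorem prime_localGenerator_of_mem_singImage [IsIntegral X.subscheme] (hX : IsLocallyPrincipal X) {y : Y}
    [IsRegularLocalRing (Y.presheaf.stalk y)] (hys : y ∈ singImage X) : Prime (localGenerator X y) := by
  have hg : stalkIdeal X y = Ideal.span {localGenerator X y} :=
    stalkIdeal_eq_span_localGenerator X y (hX y).isPrincipal_stalkIdeal.principal
  exact prime_of_stalkIdeal_eq_span X (mem_support_of_mem_singImage X hys) hg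
    (ne_zero_of_mem_singImage_of_stalkIdeal_eq X hg hys)

variable {U : Y.affineOpens} {y : Y} (hy : y ∈ (U : Y.Opens))

/-- Germ form: with `X(U) = (F)`, the germ of `F` at a point of the non-regular locus is a prime element. [folklore] -/
theorem prime_germ_of_mem_singImage [IsIntegral X.subscheme] [IsRegularLocalRing (Y.presheaf.stalk y)] {F : Γ(Y, U)}
    (hF : X.ideal U = Ideal.span {F}) (hys : y ∈ singImage X) : Prime ((Y.presheaf.germ (U : Y.Opens) y hy).hom F) :=
  prime_of_stalkIdeal_eq_span X (mem_support_of_mem_singImage X hys) (stalkIdeal_eq_span_germ (hy := hy) X hF)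
    (germ_ne_zero_of_mem_singImage X U hy hF hys)

/-- **Model form**: with `X(U) = (F)`, `A = Γ(Y, U)`, `𝔮` the prime of `y ∈ singImage X`: `F/1 ∈ A_𝔮` is a prime element
(transport along `stalkEquiv : A_𝔮 ≃ 𝒪_{Y,y}`). [folklore] -/
theorem prime_algebraMap_of_mem_singImage [IsIntegral X.subscheme] [IsRegularLocalRing (Y.presheaf.stalk y)]
    {F : Γ(Y, U)} (hF : X.ideal U = Ideal.span {F}) (hys : y ∈ singImage X) :
    Prime (algebraMap Γ(Y, U) (Localization.AtPrime (U.2.primeIdealOf ⟨y, hy⟩).asIdeal) F) := by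
  have h := prime_germ_of_mem_singImage X hy hF hys
  rw [← stalkEquiv_algebraMap U hy F] at h
  exact (MulEquiv.prime_iff (stalkEquiv U hy).toMulEquiv).mp h

end Prime

/-! ## `1 ≤ ι` on the non-regular locus of an integral hypersurface; `0 < ι_max` -/

section Pos

variable {p : ℕ} (ι : (R : Type) → [CommRing R] → R → Ordinal.{0})
  (J : (R : Type) → [CommRing R] → R → ℕ → Ideal R)

/-- **`1 ≤ ι` at every point of the non-regular locus of an integral hypersurface.**  For `ι`, `J` with (c6), (c12a), (c7)
and the canonical game clause (c9′) in characteristic `p`; `k` perfect of characteristic `p`, `Y → Spec k` smooth, `X`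
locally principal with `V(X)` integral, `y ∈ singImage X`: the position `(Γ(Y,U)_𝔮, F/1)` of a principal chart at `y` is an
e.f.t. regular local position over `k` with `F/1` PRIME and in `𝔪²`, so `one_le_iota_of_prime` gives `1 ≤ ι` there, and
`iotaAt ι X y` is that value (`iotaAt_eq_iota_localization`). [folklore] -/
theorem one_le_iotaAt_of_mem_singImage (hc6 : IotaIsoInvariant ι) (hu : IotaUnitInvariant ι)
    (hc7 : IotaGenerizationMonotone ι) (hgame : CanonicalGameClause p ι J)
    {k : Type} [Field k] [CharP k p] [PerfectField k] {Y : Scheme.{0}} (f : Y ⟶ Spec (.of k)) [Smooth f]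
    (X : Y.IdealSheafData) (hX : IsLocallyPrincipal X) [IsIntegral X.subscheme] {y : Y} (hys : y ∈ singImage X) :
    1 ≤ iotaAt ι X y := by
  -- a principal affine chart `(U₀, F)` at `y` and the model `(Γ(Y,U₀), 𝔮_y, F)`, of finite type over `k`
  obtain ⟨U₀, hyU₀, F, hF⟩ := hX y
  have hft : RingHom.FiniteType (f.appLE ⊤ U₀ le_top).hom :=
    HasRingHomProperty.appLE @LocallyOfFiniteType f inferInstance ⟨⊤, isAffineOpen_top _⟩ U₀ le_top
  let φ : k →+* Γ(Y, U₀) := (f.appLE ⊤ U₀ le_top).hom.comp (Scheme.ΓSpecIso (.of k)).inv.hom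
  have hφ : φ.FiniteType :=
    hft.comp (RingHom.FiniteType.of_surjective _
      (Scheme.ΓSpecIso (.of k)).commRingCatIsoToRingEquiv.symm.surjective)
  letI : Algebra k Γ(Y, U₀) := φ.toAlgebra
  haveI : Algebra.FiniteType k Γ(Y, U₀) := hφ
  set 𝔪 := (U₀.2.primeIdealOf ⟨y, hyU₀⟩).asIdeal with h𝔪
  haveI : IsRegularLocalRing (Y.presheaf.stalk y) := isRegularLocalRing_stalk_of_smooth_of_field f y
  haveI hreg𝔪 : IsRegularLocalRing (Localization.AtPrime 𝔪) :=
    IsRegularLocalRing.of_ringEquiv (stalkEquiv U₀ hyU₀).symm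
  -- the local equation: prime, non-zero, in `𝔪²`
  have hprime : Prime (algebraMap Γ(Y, U₀) (Localization.AtPrime 𝔪) F) :=
    prime_algebraMap_of_mem_singImage X hyU₀ hF hys
  have hF2 : algebraMap Γ(Y, U₀) (Localization.AtPrime 𝔪) F ∈ maximalIdeal (Localization.AtPrime 𝔪) ^ 2 :=
    (mem_singImage_iff_algebraMap_mem_sq X U₀ hyU₀ hF hprime.ne_zero).mp hys
  rw [iotaAt_eq_iota_localization ι (hy := hyU₀) f hc6 hu X hF]
  exact one_le_iota_of_prime ι J hc7 hgame k hprime hF2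

/-- **`0 < ι_max` on a singular integral hypersurface pair** (the `M > 0` step of [S6]: a regular successor has
`iotaMax = 0 < iotaMax` of the pair it came from). [folklore] -/
theorem iotaMax_pos (hc6 : IotaIsoInvariant ι) (hu : IotaUnitInvariant ι) (hc7 : IotaGenerizationMonotone ι)
    (hgame : CanonicalGameClause p ι J) {k : Type} [Field k] [CharP k p] [PerfectField k] {Y : Scheme.{0}}
    (f : Y ⟶ Spec (.of k)) [Smooth f] (X : Y.IdealSheafData) (hX : IsLocallyPrincipal X) [IsIntegral X.subscheme]
    (hsing : ¬ Scheme.IsRegular X.subscheme) : 0 < iotaMax ι X := by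
  obtain ⟨y, hys⟩ := (singImage_nonempty_iff X).mpr hsing
  exact lt_of_lt_of_le (Order.one_le_iff_pos.mp (one_le_iotaAt_of_mem_singImage ι J hc6 hu hc7 hgame f X hX hys))
    (iotaAt_le_iotaMax ι X hys)

end Pos

end Summit.ResolutionOfSingularities.ResolutionOfSingularities.Cruxes.HypersurfaceCentreConstruction.LocalEngine

end
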